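import Literature.Analysis.FluidPDE.NSEnstrophyPersistence
import Literature.Analysis.FluidPDE.TaoFiniteEnergyLerayHopf
import Literature.Analysis.FluidPDE.LerayHopfMild
import HarnessLib

/-!
# Discharge of `tao2011_hasBoundedSobolevNormsOn_of_isMildNSSolutionOn` (Tao 2011, Thm. 5.4 (iv))

Analysis/FluidPDE proof file for the named fact
`Literature.Analysis.FluidPDE.tao2011_hasBoundedSobolevNormsOn_of_isMildNSSolutionOn`
(`TaoH1Mild.lean`), i.e. Tao 2011, Thm. 5.4 (iv) together with the note closing its proof — held
arXiv text arXiv:1108.1165, Theorem 31 (iv), p. 18: "(iv) (Regularity) If `(u, p, u₀, f, T, 1)` is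
a `H¹` mild solution, and `(u₀, f, T)` is Schwartz, then `u` and `p` are smooth; in fact, one has
`∂ₜʲu, ∂ₜʲp ∈ L^∞_t H^k([0, T] × ℝ³)` for all `j, k ≥ 0`", and (end of the proof, same page)
"these arguments did not require the full power of the hypothesis that `(u₀, f, T)` was
Schwartz; it would have sufficed to have `u₀ ∈ H^k_x(ℝ³)` and `f ∈ C^j_t H^k_x(ℝ³)` for all
`j, k ≥ 0`" — as vendored there: `f = 0`, `ν > 0` (footnote-3 rescaling), conclusion `j = 0`
(`HasBoundedSobolevNormsOn (Icc 0 T) u`), for velocities that are classical solutions on the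
closed slab `[0, T] × ℝ³`, lie in `X¹([0, T] × ℝ³)` (`MemSobolevX 1 T u`), satisfy the tested
Duhamel formula from their datum (`IsMildNSSolutionOn (Icc 0 T) ν 0 (u 0) u`) and have
`u 0 ∈ H^k_x` for every `k`.

## The proof

One line. The tree already proves the same conclusion from the same hypotheses **without** the
mild-solution hypothesis: `tao2011_hasBoundedSobolevNormsOn_of_memSobolevX_holds`
(`NSEnstrophyPersistence.lean`, discharging `tao2011_hasBoundedSobolevNormsOn_of_memSobolevX` of
`TaoLocalisation.lean` — Tao 2011, Cor. 4.3 + Thm. 5.4 (iv) for classical solutions on the closed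
slab — by the physical-space energy method for the differentiated vorticity equation, localised
with smooth cutoffs, closed by the Gagliardo–Nirenberg–Sobolev and Grönwall inequalities and an
induction on the Sobolev level starting from the `X¹` hypothesis; Majda–Bertozzi 2002, §3.2,
Prop. 3.7). The hypotheses of the present fact are those of
`tao2011_hasBoundedSobolevNormsOn_of_memSobolevX` plus
`IsMildNSSolutionOn (Icc 0 T) ν 0 (u 0) u`, so it follows by discarding that hypothesis. (For
classical `X¹` solutions the discarded hypothesis is in any case a consequence of the others —
Tao 2011, Cor. 4.3, the named fact `tao2011_isMildNSSolutionOn_of_memSobolevX` of `TaoH1Mild.lean`;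
it is neither used nor discharged here.)

## Why a sibling file

The theorem cannot be appended to `TaoH1Mild.lean`: `NSEnstrophyPersistence` imports
`TaoEnstrophyLocalisationParts`, which imports `TaoH1Mild` (it takes the present fact as the
hypothesis `hB₂` of `tao2011_hasBoundedSobolevNormsOn_of_leaves`), so placing the proof there
would close an import cycle. No statement of the tree is modified and nothing is defined.

## Mathlib / tree search

`lean search 'of_isMildNSSolutionOn'`: the fact (`TaoH1Mild.lean`) and its two consumers as a
hypothesis (`TaoH1Mild.tao2011_hasBoundedSobolevNormsOn_of_memSobolevX_of_parts`,
`TaoEnstrophyLocalisationParts.tao2011_hasBoundedSobolevNormsOn_of_leaves`); no `_holds` before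
this file. Mathlib has no Navier–Stokes material.

## References

* T. Tao, *Localisation and compactness properties of the Navier–Stokes global regularity
  problem*, Anal. PDE 6 (2013), 25–107 = arXiv:1108.1165 (`Tao2011`): Thm. 5.4 (iv) and the
  note closing its proof (held arXiv text: Theorem 31 (iv), p. 18); Cor. 4.3 (held text:
  Corollary 27, p. 15).
* A. J. Majda, A. L. Bertozzi, *Vorticity and Incompressible Flow*, CUP (2002), §3.2, Prop. 3.7
  (the `H^m` energy estimate behind `tao2011_hasBoundedSobolevNormsOn_of_memSobolevX_holds`).

# Part 2 — Discharge of `tao2011_isMildNSSolutionOn_of_memSobolevX` (Tao 2011, Cor. 4.3)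

The second named fact of `TaoH1Mild.lean`,
`Literature.Analysis.FluidPDE.tao2011_isMildNSSolutionOn_of_memSobolevX` — Tao 2011, **Cor. 4.3**
(*Almost smooth `H¹` solutions are essentially mild*; held arXiv text: Corollary 27, p. 15), in the
vendored form: a classical solution `(u, p)` of the unforced system (`ν > 0`) on the **closed**
slab `[0, T] × ℝ³`, `T > 0`, lying in Tao's class `X¹([0, T] × ℝ³)` (`MemSobolevX 1 T u`) is a mild
solution on `[0, T]` from its datum `u 0` in the tested (duality) form
`IsMildNSSolutionOn (Icc 0 T) ν 0 (u 0) u` — is discharged below as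
`tao2011_isMildNSSolutionOn_of_memSobolevX_holds`, again in this sibling file so that the heavy
imports of the proof (`TaoFiniteEnergyLerayHopf`, `LerayHopfMild`) stay out of the statement file.

## Source and proof of Part 2

Printed proof of Cor. 4.3 (arXiv p. 15): "By Lemma 4.1 (i) [held text Lemma 25 (i), *reduction to
normalised pressure*], `∇p` is equal to `∇p̃` almost everywhere […]. The claim then follows from
(ns) and the Duhamel formula." The tree contains this chain; it is assembled here:

1. `X¹ ⊂ L^∞_t L²_x`: the order-`0` bound of `MemSobolevX 1 T u` is Tao's finite energy condition
   (6), `sup_{t ∈ [0,T]} ∫|u(t)|² ≤ C < ∞`.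
2. `isLerayHopfOn_of_finiteEnergy` (`TaoFiniteEnergyLerayHopf.lean`, proved): a finite energy
   classical solution on the closed slab is a Leray–Hopf weak solution on `[0, T)` from `u(0)` —
   this is where Lemma 4.1 (i) (`tao_pressure_normalisation_holds`) disposes of the given pressure,
   exactly as in the printed proof, together with the energy class of Lemma 8.1 (held text
   Lemma 44, p. 24).
3. `IsLerayHopfOn.isMildNSSolutionOn_Ioc` (`LerayHopfMild.lean`, proved; Fabes–Jones–Rivière 1972,
   Thm. 2.1 (i) ⇒ (ii)): a Leray–Hopf solution in dimension `3` with `L²` datum is a mild solution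
   on `(0, T]` in the tested form — the Duhamel formula paired with divergence-free test fields.
4. The endpoint `t = 0`: the slice `u 0` is smooth and classically divergence free, hence weakly
   divergence free (`VectorCalculus.IsDivFree.isWeaklyDivFree_holds`), and the duality identity from
   the datum `u 0` at time `0` is the tautology `∫⟪u 0, φ⟫ = ∫⟪u 0, φ⟫`
   (`isMildNSSolutionFrom_zero_iff`).

## References for Part 2

* T. Tao, arXiv:1108.1165 = Anal. PDE 6 (2013) (`Tao2011`): Cor. 4.3 and its proof (held text
  Cor. 27, p. 15), Lemma 4.1 (i) (Lemma 25, p. 14), Lemma 8.1 (Lemma 44, p. 24); `H¹` mild solutions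
  and the Duhamel formula (12)–(13): §1, held text pp. 5–6.
* E. B. Fabes, B. F. Jones, N. M. Rivière, *The initial value problem for the Navier–Stokes
  equations with data in `Lᵖ`*, Arch. Rational Mech. Anal. 45 (1972), Thm. 2.1
  (`FabesJonesRiviere1972`).
-/

noncomputable section

open Set
open MeasureTheory Function Filter Topology
open scoped ENNReal NNReal InnerProductSpace RealInnerProductSpace ContDiff

namespace Literature.Analysis.FluidPDE

/-- **Discharge of `tao2011_hasBoundedSobolevNormsOn_of_isMildNSSolutionOn`** (Tao 2011,
Thm. 5.4 (iv) with the note closing its proof; held arXiv text Theorem 31 (iv), p. 18; vendored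
for `f = 0`, `ν > 0`, `j = 0` and classical solutions on the closed slab `[0, T] × ℝ³`): a
classical solution `(u, p)` of Navier–Stokes on `[0, T] × ℝ³` lying in `X¹([0, T] × ℝ³)`, mild
from its datum in the tested sense, whose datum `u 0` has all derivatives in `L²`, has all
Sobolev norms bounded on `[0, T]`. Proof: the proved tree theorem
`tao2011_hasBoundedSobolevNormsOn_of_memSobolevX_holds` (`NSEnstrophyPersistence.lean`, vorticity
energy method) reaches the conclusion from the classical, `X¹` and datum hypotheses alone; the
mild-solution hypothesis is discarded. [cite: Tao2011, Thm. 5.4 (iv)] -/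
theorem tao2011_hasBoundedSobolevNormsOn_of_isMildNSSolutionOn_holds :
    tao2011_hasBoundedSobolevNormsOn_of_isMildNSSolutionOn :=
  fun _ν _T hν hT _u _p hsol hX _hmild h₀ =>
    tao2011_hasBoundedSobolevNormsOn_of_memSobolevX_holds hν hT hsol hX h₀


/-! ## Part 2: Cor. 4.3 — classical `X¹` solutions on the closed slab are mild from their datum -/

section Cor43

/-- **Discharge of `tao2011_isMildNSSolutionOn_of_memSobolevX` (Tao 2011, Cor. 4.3; arXiv
Cor. 27, p. 15).** A classical solution `(u, p)` of the unforced Navier–Stokes system with `ν > 0`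
on the closed slab `[0, T] × ℝ³`, `T > 0`, lying in `X¹([0, T] × ℝ³)`, is a mild solution on
`[0, T]` from `u 0` in the tested form. Proof as printed (Lemma 4.1 (i) + Duhamel), through the
tree's proved chain: finite energy (order `0` of `X¹`) ⇒ Leray–Hopf from `u 0`
(`isLerayHopfOn_of_finiteEnergy`, which uses Lemma 4.1 (i)) ⇒ mild on `(0, T]`
(`IsLerayHopfOn.isMildNSSolutionOn_Ioc`, Fabes–Jones–Rivière 1972, Thm. 2.1); at `t = 0` the
identity is a tautology and `u 0` is weakly divergence free because it is classically so.
[cite: Tao2011, Cor. 4.3] -/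
theorem tao2011_isMildNSSolutionOn_of_memSobolevX_holds :
    tao2011_isMildNSSolutionOn_of_memSobolevX := by
  intro ν T hν hT u p hsol hX
  -- (1) finite energy from the order-`0` part of `X¹`
  obtain ⟨C, hC⟩ := hX.exists_bound (Nat.zero_le 1)
  have hE : ∀ t ∈ Icc 0 T, ∫⁻ x, ‖u t x‖ₑ ^ 2 ≤ (C : ℝ≥0∞) := fun t ht => by
    refine le_of_eq_of_le (lintegral_congr fun x => ?_) (hC t ht)
    rw [← ofReal_norm, ← ofReal_norm, norm_iteratedFDeriv_zero]
  have hfe : ∃ A : ℝ≥0∞, A < ⊤ ∧ ∀ t ∈ Icc 0 T, ∫⁻ x, ‖u t x‖ₑ ^ 2 ≤ A :=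
    ⟨C, ENNReal.coe_lt_top, hE⟩
  -- (2) Leray–Hopf on `[0, T)` from `u 0` (Tao, Lemma 8.1 with Lemma 4.1 (i))
  obtain ⟨hLH, -⟩ := isLerayHopfOn_of_finiteEnergy hsol hν hT hfe
  -- (3) mild on `(0, T]` (Fabes–Jones–Rivière)
  have h0 : (0 : ℝ) ∈ Icc 0 T := left_mem_Icc.2 hT.le
  have hu₀ : MemLp (u 0) 2 volume :=
    memLp_two_of_lintegral_lt_top (hsol.contDiff_velocity h0).continuous
      ((hE 0 h0).trans_lt ENNReal.coe_lt_top)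
  have hmild : IsMildNSSolutionOn (Ioc 0 T) ν 0 (u 0) u :=
    hLH.isMildNSSolutionOn_Ioc finrank_euclideanSpace_fin hu₀ hν hT
  -- (4) the endpoint `t = 0`
  refine ⟨fun t ht => ?_, fun t ht => ?_⟩
  · rcases ht.1.eq_or_lt with rfl | ht0
    · exact VectorCalculus.IsDivFree.isWeaklyDivFree_holds (hsol.divFree 0 h0)
        ((hsol.contDiff_velocity h0).of_le (by norm_cast))
    · exact hmild.1 t ⟨ht0, ht.2⟩
  · rcases ht.1.eq_or_lt with rfl | ht0
    · exact isMildNSSolutionFrom_zero_iff.2 fun _ _ _ => rfl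
    · exact hmild.2 t ⟨ht0, ht.2⟩

end Cor43

end Literature.Analysis.FluidPDE

end
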